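import Literature.Analysis.FluidPDE.ForwardDSSEnergyFromZero
import Literature.Analysis.FluidPDE.ForwardDSSPressureEstimate
import HarnessLib

/-!
# Forward DSS solutions: the a priori estimate (3.12) of Bradshaw–Tsai 2019 — the discharge

Analysis/FluidPDE proof file (theorems only, no definitions, no notation) **discharging** the
named fact `Literature.Analysis.FluidPDE.bradshawTsai2019_apriori_3_12`
(`ForwardDSSMollifiedScheme.lean`): the a priori estimate (3.12) with the pressure bound of
p. 10 of Bradshaw–Tsai, Analysis & PDE 12 (2019) = arXiv:1801.08060, §3, proof of Prop. 3.1,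
for every member of the class `BradshawTsai2019.IsMollifiedApproximant` and `0 < ε ≤ ε₀(λ, η)`,
with a constant `C₀ = C(λ, η, γ)` uniform in `ε`, in the datum and in the member
(`bradshawTsai2019_apriori_3_12_holds`). With the accepted assemblies of
`ForwardDSSMollifiedScheme.lean` (`bradshawTsai2019_prop_3_1_approximation_of_parts`, …) the trust
base of Prop. 3.1 in the tree is thereby reduced to the construction fact
`bradshawTsai2019_mollifiedScheme` ([BT1]'s scheme with its approximants in the class).

## The printed proof and its bricks

> "Combining the above estimates (and taking `γ` sufficiently small to absorb the gradient
> terms on the right hand side), we obtain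
> (3.12) `α_ε(t) + ∫₀ᵗ∫_{B₁}|∇v_ε|² dx ds ≤ α₀ + C(λ,η,γ)∫₀ᵗ(α̃_ε(s)³ + α̃_ε(s)¹) ds`." (p. 10)

"The above estimates" are, in the tree:

* (3.7) from `t = 0` for the weight `φ = χ²` with moduli on the right —
  `IsMollifiedApproximant.energy_ineq_zero` (`ForwardDSSEnergyFromZero`);
* "The first term is bounded by `α₀`" — `χ² ≤ 1`, `χ = 0` off `B_λ`;
* the second term, `≤ C(λ)∫₀ᵗα̃_ε` by (3.6) — `setLIntegral_cylinder_enorm_sq_le_of_dss`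
  (`ForwardDSSLocalEnergyScaling`);
* the cubic term, (3.9)–(3.11) and Gagliardo–Nirenberg — `setLIntegral_cylinder_sq_mul_drift_le`
  (`ForwardDSSLocalEnergyCubic`) and `exists_setLIntegral_unitCylinder_cube_le`
  (`ForwardDSSPressureEstimate`, constant uniform in the field);
* the pressure term `∫∫2π_ε(v_ε·∇φ)`, "After using Hölder's inequality, (3.11), the above bounds,
  and `α^{3/2} ≤ α + α³`" — here Young `|π_ε||v_ε| ≤ |π_ε|^{3/2} + |v_ε|³`, the pressure bound of
  p. 10 from the formula (3.8) recorded in the class,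
  `exists_setLIntegral_cylinder_pressure_rpow_le` (`ForwardDSSPressureEstimate`, over the tree's
  proved Calderón–Zygmund theorem), and the cubic bound re-scaled to `B₁`
  (`setLIntegral_cylinder_enorm_cube_le_of_dss`);
* "taking `γ` sufficiently small": with `K₁ = ‖Δφ‖_∞λ³`, `K₂ = ‖∇φ‖_∞(λ² + λ⁴)`, `K₃ = 2‖∇φ‖_∞`
  the gradient coefficient is `Sγ`, `S = K₂ + K₃(1 + λ²)`, and `γ = (S + 1)⁻¹`;
* the absorption itself (`add_le_of_add_two_mul_le`) uses the finiteness of `∫₀ᵗ∫φ|∇v_ε|²`, which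
  is the energy class `L²(0,T;H¹(K))` of the approximants recorded in the class (`dissipation`);
* the pressure bound `∫₀ᵗ∫_{B₁}|π_ε|^{3/2} ≤ C₀(α₀ + ∫₀ᵗ(α̃³ + α̃))` is the `L^{3/2}(0,t;L^{3/2}(B_λ))`
  bound plus the absorbed energy bound for its gradient term, with `C₀ = C' + C_p + 1`,
  `C' = K₁ + K₂C_c + K₃(C_p + λ²C_c)`.

The cut-offs are Mathlib bump functions (`exists_cutoff`: `χ = 1` on `B₁`, `χ = 0` off
`B_{(1+λ)/2}`, so that `supp φ ⊂ B_λ` strictly and `Δφ`, `∇φ` vanish off the *open* ball `B_λ` on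
which the bricks are stated; `exists_splitting_cutoff`: the smooth substitute `ζ` for `χ_{B_{λ²}}`
in the near/far splitting of p. 10); `ε₀ = (λ − 1)/ρ` where `η = 0` off `B_ρ` ("By taking `ε`
sufficiently small we can ensure that, whenever `s < 1`, `supp η_{ε√s} ⊂ B_{λ−1}`", p. 9).

## Mathlib / tree search

Reused, nothing redefined: the class and the fact (`ForwardDSSMollifiedScheme`), the bricks
listed above, `setLIntegral_prod_univ_le_of_eq_zero_off` (`ForwardDSSEnergyFromZero`),
`aestronglyMeasurable_restrict_of_continuousOn` (`ForwardDSSLocalEnergyCubic`),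
`continuous_laplacian`, `continuous_gradient_of_contDiff`, `laplacian_eq_zero_of_notMem_tsupport`,
`gradient_eq_zero_of_notMem_tsupport` (`WholeSpaceIBP`), `MemWeakLp.setLIntegral_enorm_sq_lt_top_of_two_lt`
(`WeakLpLocal`); Mathlib's `ContDiffBump`, `ENNReal.young_inequality`, `ENNReal.mul_inv_cancel`.
`lean search 'apriori_3_12_holds'`: no prior discharge.

## References

* Z. Bradshaw, T.-P. Tsai, *Discretely self-similar solutions to the Navier–Stokes equations with
  data in `L²_loc` satisfying the local energy inequality*, Analysis & PDE 12 (2019) 1943–1962 =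
  arXiv:1801.08060, §3, proof of Prop. 3.1: (3.7)–(3.12) and the pressure bounds of p. 10
  [BradshawTsai2019].
-/

noncomputable section

open MeasureTheory Set Function Filter Topology TopologicalSpace Metric Module
open scoped NNReal ENNReal RealInnerProductSpace ContDiff Laplacian

namespace Literature.Analysis.FluidPDE

namespace BradshawTsai2019

/-! ## Elementary `ℝ≥0∞` bookkeeping -/

/-- **Absorption**: `a + 2D ≤ b + D` with `D < ∞` gives `a + D ≤ b` ("Provided `γ` is small
enough, the gradient term can be absorbed into the left hand side of (3.7)", Bradshaw–Tsai 2019,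
p. 9). [cite: BradshawTsai2019, §3 p. 9 (absorption)] -/
theorem add_le_of_add_two_mul_le {a b D : ℝ≥0∞} (hD : D ≠ ⊤) (h : a + 2 * D ≤ b + D) :
    a + D ≤ b := by
  rw [two_mul, ← add_assoc] at h
  exact (ENNReal.add_le_add_iff_right hD).1 h

/-- Young for the pressure–velocity product: `xy ≤ x^{3/2} + y³` in `ℝ≥0∞` ("After using Hölder's
inequality …", p. 10; Mathlib's `ENNReal.young_inequality` with exponents `3/2`, `3`). [folklore] -/
theorem mul_le_rpow_three_halves_add_rpow_three (x y : ℝ≥0∞) :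
    x * y ≤ x ^ (3 / 2 : ℝ) + y ^ (3 : ℝ) := by
  have hpq : (3 / 2 : ℝ).HolderConjugate 3 := Real.holderConjugate_iff.2 ⟨by norm_num, by norm_num⟩
  refine (ENNReal.young_inequality x y hpq).trans (add_le_add ?_ ?_)
  · exact ENNReal.div_le_of_le_mul (le_mul_of_one_le_right' (by
      rw [← ENNReal.ofReal_one]; exact ENNReal.ofReal_le_ofReal (by norm_num)))
  · exact ENNReal.div_le_of_le_mul (le_mul_of_one_le_right' (by
      rw [← ENNReal.ofReal_one]; exact ENNReal.ofReal_le_ofReal (by norm_num)))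

/-! ## Cut-offs -/

/-- **The cut-off `χ` of p. 8** ("Fix `χ ∈ C^∞(ℝ)` with `χ(t) = 1` if `t ≤ 1` and `χ(t) = 0` if
`t ≥ λ`"; here radial on `ℝ³`, supported strictly inside `B_λ`): for `1 < λ` there is a smooth
`χ : ℝ³ → ℝ` with `0 ≤ χ ≤ 1`, `χ = 1` on `B₁`, `χ = 0` off `B_{(1+λ)/2}`, of compact support, with
bounded derivative (Mathlib's `ContDiffBump`). [cite: BradshawTsai2019, §3 proof of Prop 3.1 (p. 8, the cut-off χ)] -/
theorem exists_cutoff {c : ℝ} (hc : 1 < c) :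
    ∃ χ : EuclideanSpace ℝ (Fin 3) → ℝ, ContDiff ℝ ∞ χ ∧ HasCompactSupport χ ∧
      (∀ x, 0 ≤ χ x ∧ χ x ≤ 1) ∧ (∀ x ∈ ball (0 : EuclideanSpace ℝ (Fin 3)) 1, χ x = 1) ∧
      (∀ x, (1 + c) / 2 ≤ ‖x‖ → χ x = 0) ∧ ∃ M : ℝ, ∀ x, ‖fderiv ℝ χ x‖ ≤ M := by
  have key : ∀ f : ContDiffBump (0 : EuclideanSpace ℝ (Fin 3)), f.rIn = 1 → f.rOut = (1 + c) / 2 →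
      ∃ χ : EuclideanSpace ℝ (Fin 3) → ℝ, ContDiff ℝ ∞ χ ∧ HasCompactSupport χ ∧
        (∀ x, 0 ≤ χ x ∧ χ x ≤ 1) ∧ (∀ x ∈ ball (0 : EuclideanSpace ℝ (Fin 3)) 1, χ x = 1) ∧
        (∀ x, (1 + c) / 2 ≤ ‖x‖ → χ x = 0) ∧ ∃ M : ℝ, ∀ x, ‖fderiv ℝ χ x‖ ≤ M := by
    intro f hIn hOut
    have hs : ContDiff ℝ ∞ f := f.contDiff
    have hs1 : ContDiff ℝ 1 f := f.contDiff
    have hcs : HasCompactSupport f := f.hasCompactSupport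
    obtain ⟨M, hM⟩ := (hs1.continuous_fderiv one_ne_zero).bounded_above_of_compact_support (hcs.fderiv (𝕜 := ℝ))
    refine ⟨f, hs, hcs, fun x => ⟨f.nonneg, f.le_one⟩, fun x hx => ?_, fun x hx => ?_, M, hM⟩
    · exact f.one_of_mem_closedBall (by rw [hIn]; exact ball_subset_closedBall hx)
    · exact f.zero_of_le_dist (by rw [hOut, dist_zero_right]; exact hx)
  exact key ⟨1, (1 + c) / 2, one_pos, by linarith⟩ rfl rfl

/-- **The cut-off `ζ` of the near/far splitting** (a smooth substitute for the printed
`χ_{B_{λ²}}`, p. 10): `0 ≤ ζ ≤ 1`, `ζ = 1` on `B_{λ²}`, `ζ = 0` off `B_{λ³}`, smooth. [cite: BradshawTsai2019, §3 proof of Prop 3.1 (p. 10, splitting π_near + π_far)] -/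
theorem exists_splitting_cutoff {c : ℝ} (hc : 1 < c) :
    ∃ ζ : EuclideanSpace ℝ (Fin 3) → ℝ, ContDiff ℝ ∞ ζ ∧ (∀ y, |ζ y| ≤ 1) ∧
      (∀ y, ‖y‖ < c ^ 2 → ζ y = 1) ∧ (∀ y, c ^ 3 ≤ ‖y‖ → ζ y = 0) := by
  have hc0 : 0 < c := one_pos.trans hc
  have key : ∀ g : ContDiffBump (0 : EuclideanSpace ℝ (Fin 3)), g.rIn = c ^ 2 → g.rOut = c ^ 3 →
      ∃ ζ : EuclideanSpace ℝ (Fin 3) → ℝ, ContDiff ℝ ∞ ζ ∧ (∀ y, |ζ y| ≤ 1) ∧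
        (∀ y, ‖y‖ < c ^ 2 → ζ y = 1) ∧ (∀ y, c ^ 3 ≤ ‖y‖ → ζ y = 0) := by
    intro g hIn hOut
    refine ⟨g, g.contDiff, fun y => abs_le.2 ⟨by linarith [g.nonneg' y], g.le_one⟩, fun y hy => ?_,
      fun y hy => ?_⟩
    · exact g.one_of_mem_closedBall (by rw [hIn, mem_closedBall, dist_zero_right]; exact hy.le)
    · exact g.zero_of_le_dist (by rw [hOut, dist_zero_right]; exact hy)
  exact key ⟨c ^ 2, c ^ 3, by positivity, pow_lt_pow_right₀ hc (by norm_num)⟩ rfl rfl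

end BradshawTsai2019

open BradshawTsai2019

/-! ## The assembly -/

/-- **Bradshaw–Tsai 2019, the a priori estimate (3.12) with the pressure bound of p. 10,
discharged** (arXiv:1801.08060, §3, proof of Prop. 3.1, pp. 8–10): the named fact
`bradshawTsai2019_apriori_3_12` of `ForwardDSSMollifiedScheme.lean` holds. Proof, as printed:
fix `λ > 1` and the mollifier `η` (`η = 0` off `B_ρ`); take `ε₀ = (λ−1)/ρ` ("By taking `ε`
sufficiently small we can ensure that, whenever `s < 1`, `supp η_{ε√s} ⊂ B_{λ−1}`", p. 9), the
cut-off `φ = χ²` (`exists_cutoff`) and the splitting cut-off `ζ` (`exists_splitting_cutoff`).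
For a member `(v_ε, π_ε)` of the class and `0 < t ≤ 1`, the local energy inequality (3.7) from
`t = 0` with the weight `φ` (accepted `IsMollifiedApproximant.energy_ineq_zero`) reads
`∫|v_ε(t)|²φ + 2∫₀ᵗ∫φ|∇v_ε|² ≤ ∫|v₀|²φ + ∫₀ᵗ∫(|v_ε|²|Δφ| + |v_ε|²|η_{ε√s}*v_ε||∇φ| + 2|π_ε||v_ε||∇φ|)`;
the first term is `≤ α₀ = ‖v₀‖²_{L²(B_λ)}`; the second is `≤ C(λ)∫₀ᵗα̃_ε` by (3.6) (accepted
`setLIntegral_cylinder_enorm_sq_le_of_dss`); the cubic term is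
`≤ C(λ,γ,η)∫₀ᵗ(α̃³_ε + α̃_ε) + C(λ)γ∫₀ᵗ∫φ|∇v_ε|²` by (3.9)–(3.11) and Gagliardo–Nirenberg (accepted
`setLIntegral_cylinder_sq_mul_drift_le`, `exists_setLIntegral_unitCylinder_cube_le`); the
pressure term is bounded by Young (`|π_ε||v_ε| ≤ |π_ε|^{3/2} + |v_ε|³`), the pressure bound of
p. 10 from (3.8) (accepted `exists_setLIntegral_cylinder_pressure_rpow_le`) and the cubic bound;
`γ = γ(λ, η)` is chosen so that the total gradient coefficient is `≤ 1`, and the gradient term is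
absorbed into the left hand side — legitimately, the dissipation being finite (the energy class
recorded in the class, `dissipation`) — giving **(3.12)**
`α_ε(t) + ∫₀ᵗ∫_{B₁}|∇v_ε|² ≤ α₀ + C₀∫₀ᵗ(α̃_ε³ + α̃_ε)`, `C₀ = C(λ, η, γ)` uniform in `ε ≤ ε₀`, in the
datum and in the member; and the pressure bound
`∫₀ᵗ∫_{B₁}|π_ε|^{3/2} ≤ C₀(α₀ + ∫₀ᵗ(α̃_ε³ + α̃_ε))` from the `L^{3/2}(0,t;L^{3/2}(B_λ))` bound plus
the absorbed energy bound. [cite: BradshawTsai2019, §3 proof of Prop 3.1 ((3.7)–(3.12), pressure bounds p. 10)] -/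
theorem bradshawTsai2019_apriori_3_12_holds : bradshawTsai2019_apriori_3_12 := by
  intro c hc η hη hηc hη0 hη1
  have hc0 : 0 < c := one_pos.trans hc
  -- ### the support radius of the mollifier and `ε₀`
  obtain ⟨ρ, hρ0, hηρ⟩ : ∃ ρ : ℝ, 0 < ρ ∧ ∀ y, ρ ≤ ‖y‖ → η y = 0 := by
    obtain ⟨r, hr⟩ := hηc.isCompact.isBounded.subset_ball 0
    refine ⟨max r 1, by positivity, fun y hy => image_eq_zero_of_notMem_tsupport fun h' => ?_⟩
    have h'' := hr h'
    rw [mem_ball_zero_iff] at h''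
    linarith [le_max_left r 1]
  -- ### the cut-offs `φ = χ²` and `ζ`
  obtain ⟨χ, hχs, hχcs, hχ01, hχB, hχc, M, hM⟩ := exists_cutoff hc
  obtain ⟨ζ, hζs, hζ1, hζB, hζc⟩ := exists_splitting_cutoff hc
  have hχ1 : ∀ x, |χ x| ≤ 1 := fun x => abs_le.2 ⟨by linarith [(hχ01 x).1], (hχ01 x).2⟩
  have hχs1 : ContDiff ℝ 1 χ := hχs.of_le (by norm_cast)
  have hRc : (1 + c) / 2 ≤ c := by linarith
  have hψs : ContDiff ℝ ∞ (fun x => χ x ^ 2) := hχs.pow 2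
  have hψcs : HasCompactSupport (fun x => χ x ^ 2) :=
    hχcs.comp_left (g := fun r : ℝ => r ^ 2) (zero_pow two_ne_zero)
  have hψ0 : ∀ x, 0 ≤ χ x ^ 2 := fun x => sq_nonneg _
  have hψ1 : ∀ x, χ x ^ 2 ≤ 1 := fun x => pow_le_one₀ (hχ01 x).1 (hχ01 x).2
  have hψB : ∀ x ∈ ball (0 : EuclideanSpace ℝ (Fin 3)) 1, χ x ^ 2 = 1 := fun x hx => by
    rw [hχB x hx, one_pow]
  have hψc : ∀ x, x ∉ ball (0 : EuclideanSpace ℝ (Fin 3)) c → χ x ^ 2 = 0 := fun x hx => by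
    rw [mem_ball_zero_iff, not_lt] at hx
    rw [hχc x (by linarith), zero_pow two_ne_zero]
  -- `supp φ ⊆ B̄_{(1+λ)/2} ⊆ B_λ`, so `Δφ`, `∇φ` vanish off `B_λ`
  have hts : tsupport (fun x => χ x ^ 2) ⊆ ball (0 : EuclideanSpace ℝ (Fin 3)) c := by
    refine (closure_minimal (fun x hx => ?_) isClosed_closedBall).trans
      (closedBall_subset_ball (by linarith : (1 + c) / 2 < c))
    rw [mem_closedBall_zero_iff]
    by_contra h'
    exact hx (by simp [hχc x (not_le.1 h').le])
  have hΔ0 : ∀ x, x ∉ ball (0 : EuclideanSpace ℝ (Fin 3)) c → (Δ (fun x => χ x ^ 2)) x = 0 :=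
    fun x hx => laplacian_eq_zero_of_notMem_tsupport fun h' => hx (hts h')
  have hg0 : ∀ x, x ∉ ball (0 : EuclideanSpace ℝ (Fin 3)) c → gradient (fun x => χ x ^ 2) x = 0 :=
    fun x hx => gradient_eq_zero_of_notMem_tsupport fun h' => hx (hts h')
  have hψ2 : ContDiff ℝ 2 (fun x => χ x ^ 2) := hψs.of_le (by norm_cast)
  have hψ1' : ContDiff ℝ 1 (fun x => χ x ^ 2) := hψ2.of_le one_le_two
  have hΔc : Continuous (Δ (fun x => χ x ^ 2)) := continuous_laplacian hψ2
  have hgc : Continuous (gradient (fun x => χ x ^ 2)) := continuous_gradient_of_contDiff hψ1'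
  obtain ⟨MΔ, hMΔ⟩ := hψcs.isCompact.exists_bound_of_continuousOn hΔc.continuousOn
  obtain ⟨Mg, hMg⟩ := hψcs.isCompact.exists_bound_of_continuousOn hgc.continuousOn
  have eΔ : ∀ x, ‖(Δ (fun x => χ x ^ 2)) x‖ₑ ≤ ENNReal.ofReal MΔ := fun x => by
    by_cases hx : x ∈ tsupport (fun x => χ x ^ 2)
    · rw [← ofReal_norm]; exact ENNReal.ofReal_le_ofReal (hMΔ x hx)
    · simp [laplacian_eq_zero_of_notMem_tsupport hx]
  have eg : ∀ x, ‖gradient (fun x => χ x ^ 2) x‖ₑ ≤ ENNReal.ofReal Mg := fun x => by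
    by_cases hx : x ∈ tsupport (fun x => χ x ^ 2)
    · rw [← ofReal_norm]; exact ENNReal.ofReal_le_ofReal (hMg x hx)
    · simp [gradient_eq_zero_of_notMem_tsupport hx]
  -- ### the absorption parameter `γ`
  set K₁ : ℝ≥0∞ := ENNReal.ofReal MΔ * ENNReal.ofReal (c ^ 3) with hK₁
  set K₂ : ℝ≥0∞ := ENNReal.ofReal Mg * (ENNReal.ofReal (c ^ 2) + ENNReal.ofReal (c ^ 4)) with hK₂
  set K₃ : ℝ≥0∞ := 2 * ENNReal.ofReal Mg with hK₃
  set S : ℝ≥0∞ := K₂ + K₃ * (1 + ENNReal.ofReal (c ^ 2)) with hS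
  have hK₁t : K₁ ≠ ⊤ := ENNReal.mul_ne_top ENNReal.ofReal_ne_top ENNReal.ofReal_ne_top
  have hK₂t : K₂ ≠ ⊤ := ENNReal.mul_ne_top ENNReal.ofReal_ne_top
    (ENNReal.add_ne_top.2 ⟨ENNReal.ofReal_ne_top, ENNReal.ofReal_ne_top⟩)
  have hK₃t : K₃ ≠ ⊤ := ENNReal.mul_ne_top (by norm_num) ENNReal.ofReal_ne_top
  have hSt : S ≠ ⊤ := ENNReal.add_ne_top.2 ⟨hK₂t, ENNReal.mul_ne_top hK₃t
    (ENNReal.add_ne_top.2 ⟨ENNReal.one_ne_top, ENNReal.ofReal_ne_top⟩)⟩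
  have hS1t : S + 1 ≠ ⊤ := ENNReal.add_ne_top.2 ⟨hSt, ENNReal.one_ne_top⟩
  have hS10 : S + 1 ≠ 0 := ne_of_gt (lt_of_lt_of_le zero_lt_one le_add_self)
  set γ : ℝ≥0∞ := (S + 1)⁻¹ with hγ
  have hγ0 : γ ≠ 0 := ENNReal.inv_ne_zero.2 hS1t
  have hγt : γ ≠ ⊤ := ENNReal.inv_ne_top.2 hS10
  have hγS : S * γ ≤ 1 := by
    calc S * γ ≤ (S + 1) * γ := mul_le_mul' le_self_add le_rfl
      _ = 1 := ENNReal.mul_inv_cancel hS10 hS1t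
  have hγ1 : γ ≤ 1 := ENNReal.inv_le_one.2 le_add_self
  -- ### the bricks, with constants uniform in the field
  obtain ⟨Cc, hCct, hcube⟩ := exists_setLIntegral_unitCylinder_cube_le hc hχs1 hχ1 hM hRc hχc hχB
    hγ0 hγt
  obtain ⟨Cp, hCpt, hpress⟩ := exists_setLIntegral_cylinder_pressure_rpow_le hc hη hη0 hη1 hηρ hχs1
    hχ1 hM hRc hχc hχB hζs hζ1 hζB hζc hγ0 hγt
  set C' : ℝ≥0∞ := K₁ + K₂ * Cc + K₃ * (Cp + ENNReal.ofReal (c ^ 2) * Cc) with hC'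
  have hC't : C' ≠ ⊤ := ENNReal.add_ne_top.2 ⟨ENNReal.add_ne_top.2 ⟨hK₁t, ENNReal.mul_ne_top hK₂t hCct⟩,
    ENNReal.mul_ne_top hK₃t (ENNReal.add_ne_top.2 ⟨hCpt, ENNReal.mul_ne_top ENNReal.ofReal_ne_top hCct⟩)⟩
  set C₀ : ℝ≥0∞ := C' + Cp + 1 with hC₀
  have hC₀t : C₀ ≠ ⊤ := ENNReal.add_ne_top.2 ⟨ENNReal.add_ne_top.2 ⟨hC't, hCpt⟩, ENNReal.one_ne_top⟩
  have hC'C₀ : C' ≤ C₀ := le_self_add.trans le_self_add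
  have h1C₀ : 1 ≤ C₀ := le_add_self
  have hCpC₀ : Cp + C' ≤ C₀ := by rw [add_comm]; exact le_self_add
  refine ⟨(c - 1) / ρ, div_pos (by linarith) hρ0, C₀.toNNReal, ?_⟩
  intro ε hε hεle v₀ hw hdiv hdss w ϖ h
  rw [ENNReal.coe_toNNReal hC₀t]
  have hερ : ε * ρ ≤ c - 1 := (le_div_iff₀ hρ0).1 hεle
  -- ### the member
  have hw1 : ContDiffOn ℝ 1 (uncurry w) (Ioi (0 : ℝ) ×ˢ (univ : Set (EuclideanSpace ℝ (Fin 3)))) :=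
    h.smooth.of_le (by exact_mod_cast le_top)
  have cw : ContinuousOn (uncurry w) (Ioi (0 : ℝ) ×ˢ (univ : Set (EuclideanSpace ℝ (Fin 3)))) :=
    h.smooth.continuousOn
  have cw' : ContinuousOn (fun z : ℝ × EuclideanSpace ℝ (Fin 3) => w z.1 z.2)
      (Ioi (0 : ℝ) ×ˢ (univ : Set (EuclideanSpace ℝ (Fin 3)))) := cw
  have cDw : ContinuousOn (fun z : ℝ × EuclideanSpace ℝ (Fin 3) => fderiv ℝ (w z.1) z.2)
      (Ioi (0 : ℝ) ×ˢ (univ : Set (EuclideanSpace ℝ (Fin 3)))) :=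
    continuousOn_fderiv_slice_of_contDiffOn hw1 isOpen_Ioi.uniqueDiffOn
  have hws : ∀ s, 0 < s → ContDiff ℝ ∞ (w s) := fun s hs => h.contDiff_slice hs
  have hws1 : ∀ s, 0 < s → ContDiff ℝ 1 (w s) := fun s hs => (hws s hs).of_le (by norm_cast)
  have cb' : ContinuousOn (fun z : ℝ × EuclideanSpace ℝ (Fin 3) => mollifiedDrift η ε w z.1 z.2)
      (Ioi (0 : ℝ) ×ˢ (univ : Set (EuclideanSpace ℝ (Fin 3)))) :=
    h.continuousOn_mollifiedDrift hη.continuous hηc hε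
  -- ### the datum
  have hv₀m : AEStronglyMeasurable v₀ volume := hw.aestronglyMeasurable
  have h3 : (2 : ℝ) < (3 : ℝ≥0∞).toReal := by rw [ENNReal.toReal_ofNat]; norm_num
  set α₀ : ℝ≥0∞ := ∫⁻ x in ball (0 : EuclideanSpace ℝ (Fin 3)) c, ‖v₀ x‖ₑ ^ 2 with hα₀_def
  have hα₀ : α₀ < ⊤ := hw.setLIntegral_enorm_sq_lt_top_of_two_lt h3 measure_ball_lt_top.ne
  have hfin1 : ∫⁻ x in ball (0 : EuclideanSpace ℝ (Fin 3)) 1, ‖v₀ x‖ₑ ^ 2 < ⊤ :=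
    (lintegral_mono_set (ball_subset_ball hc.le)).trans_lt hα₀
  have hA₀ψ : ∫⁻ x, ‖v₀ x‖ₑ ^ 2 * ENNReal.ofReal (χ x ^ 2) ≤ α₀ := by
    calc ∫⁻ x, ‖v₀ x‖ₑ ^ 2 * ENNReal.ofReal (χ x ^ 2)
        ≤ ∫⁻ x, (ball (0 : EuclideanSpace ℝ (Fin 3)) c).indicator (fun x => ‖v₀ x‖ₑ ^ 2) x := by
          refine lintegral_mono fun x => ?_
          by_cases hx : x ∈ ball (0 : EuclideanSpace ℝ (Fin 3)) c
          · rw [indicator_of_mem hx]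
            calc ‖v₀ x‖ₑ ^ 2 * ENNReal.ofReal (χ x ^ 2) ≤ ‖v₀ x‖ₑ ^ 2 * 1 :=
                  mul_le_mul' le_rfl (by rw [← ENNReal.ofReal_one]; exact ENNReal.ofReal_le_ofReal (hψ1 x))
              _ = ‖v₀ x‖ₑ ^ 2 := mul_one _
          · rw [indicator_of_notMem hx, hψc x hx, ENNReal.ofReal_zero, mul_zero]
      _ = α₀ := lintegral_indicator measurableSet_ball _
  -- ### the core estimate at a time `0 < t ≤ 1`
  have core : ∀ t : ℝ, 0 < t → t ≤ 1 →
      ballEnergy w t + (∫⁻ z in Ioo 0 t ×ˢ ball (0 : EuclideanSpace ℝ (Fin 3)) 1,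
          ENNReal.ofReal (frobeniusNormSq (fderiv ℝ (w z.1) z.2))) ≤
        α₀ + C' * ∫⁻ s in Ioo 0 t, (supBallEnergy w s ^ 3 + supBallEnergy w s) ∧
      (∫⁻ z in Ioo 0 t ×ˢ ball (0 : EuclideanSpace ℝ (Fin 3)) c, ‖ϖ z.1 z.2‖ₑ ^ (3 / 2 : ℝ)) ≤
        Cp * (∫⁻ s in Ioo 0 t, (supBallEnergy w s ^ 3 + supBallEnergy w s)) +
          (α₀ + C' * ∫⁻ s in Ioo 0 t, (supBallEnergy w s ^ 3 + supBallEnergy w s)) := by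
    intro t ht0 ht1
    set Φ : ℝ≥0∞ := ∫⁻ s in Ioo 0 t, (supBallEnergy w s ^ 3 + supBallEnergy w s) with hΦ
    set D : ℝ≥0∞ := ∫⁻ z in Ioo 0 t ×ˢ (univ : Set (EuclideanSpace ℝ (Fin 3))),
      ENNReal.ofReal (χ z.2 ^ 2 * frobeniusNormSq (fderiv ℝ (w z.1) z.2)) with hD_def
    set 𝔄 : ℝ≥0∞ := ∫⁻ x, ‖w t x‖ₑ ^ 2 * ENNReal.ofReal (χ x ^ 2) with h𝔄
    -- the dissipation is finite (energy class of the member)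
    have hDle : D ≤ ∫⁻ z in Ioo 0 t ×ˢ ball (0 : EuclideanSpace ℝ (Fin 3)) c,
        ENNReal.ofReal (frobeniusNormSq (fderiv ℝ (w z.1) z.2)) := by
      refine setLIntegral_prod_univ_le_of_eq_zero_off measurableSet_Ioo measurableSet_ball
        (fun z _ => ENNReal.ofReal_le_ofReal (mul_le_of_le_one_left (frobeniusNormSq_nonneg _) (hψ1 _)))
        (fun z hz => ?_)
      rw [hψc z.2 hz.2, zero_mul, ENNReal.ofReal_zero]
    have hDt : D ≠ ⊤ := (hDle.trans_lt (h.dissipation t c)).ne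
    -- (3.7) from `t = 0` with the weight `φ = χ²`
    have E := h.energy_ineq_zero hη hηc hε hψs hψcs hψ0 hv₀m (hA₀ψ.trans_lt hα₀) ht0
    -- the three terms of its right-hand side
    set R₁ : ℝ≥0∞ := ∫⁻ z in Ioo 0 t ×ˢ (univ : Set (EuclideanSpace ℝ (Fin 3))),
      ‖w z.1 z.2‖ₑ ^ 2 * ‖(Δ (fun x => χ x ^ 2)) z.2‖ₑ with hR₁
    set R₂ : ℝ≥0∞ := ∫⁻ z in Ioo 0 t ×ˢ (univ : Set (EuclideanSpace ℝ (Fin 3))),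
      ‖w z.1 z.2‖ₑ ^ 2 * ‖mollifiedDrift η ε w z.1 z.2‖ₑ * ‖gradient (fun x => χ x ^ 2) z.2‖ₑ with hR₂
    set R₃ : ℝ≥0∞ := ∫⁻ z in Ioo 0 t ×ˢ (univ : Set (EuclideanSpace ℝ (Fin 3))),
      2 * ‖ϖ z.1 z.2‖ₑ * ‖w z.1 z.2‖ₑ * ‖gradient (fun x => χ x ^ 2) z.2‖ₑ with hR₃
    have mw : AEStronglyMeasurable (fun z : ℝ × EuclideanSpace ℝ (Fin 3) => w z.1 z.2)
        (volume.restrict (Ioo (0 : ℝ) t ×ˢ (univ : Set (EuclideanSpace ℝ (Fin 3))))) :=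
      aestronglyMeasurable_restrict_of_continuousOn cw' t MeasurableSet.univ
    have mb : AEStronglyMeasurable (fun z : ℝ × EuclideanSpace ℝ (Fin 3) => mollifiedDrift η ε w z.1 z.2)
        (volume.restrict (Ioo (0 : ℝ) t ×ˢ (univ : Set (EuclideanSpace ℝ (Fin 3))))) :=
      aestronglyMeasurable_restrict_of_continuousOn cb' t MeasurableSet.univ
    have m1 : AEMeasurable (fun z : ℝ × EuclideanSpace ℝ (Fin 3) =>
        ‖w z.1 z.2‖ₑ ^ 2 * ‖(Δ (fun x => χ x ^ 2)) z.2‖ₑ)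
        (volume.restrict (Ioo (0 : ℝ) t ×ˢ (univ : Set (EuclideanSpace ℝ (Fin 3))))) :=
      (mw.enorm.pow_const 2).mul (hΔc.comp continuous_snd).aestronglyMeasurable.enorm
    have m2 : AEMeasurable (fun z : ℝ × EuclideanSpace ℝ (Fin 3) =>
        ‖w z.1 z.2‖ₑ ^ 2 * ‖mollifiedDrift η ε w z.1 z.2‖ₑ * ‖gradient (fun x => χ x ^ 2) z.2‖ₑ)
        (volume.restrict (Ioo (0 : ℝ) t ×ˢ (univ : Set (EuclideanSpace ℝ (Fin 3))))) :=
      ((mw.enorm.pow_const 2).mul mb.enorm).mul (hgc.comp continuous_snd).aestronglyMeasurable.enorm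
    have hsplit : (∫⁻ z in Ioo 0 t ×ˢ (univ : Set (EuclideanSpace ℝ (Fin 3))),
        (‖w z.1 z.2‖ₑ ^ 2 * ‖(Δ (fun x => χ x ^ 2)) z.2‖ₑ +
          ‖w z.1 z.2‖ₑ ^ 2 * ‖mollifiedDrift η ε w z.1 z.2‖ₑ * ‖gradient (fun x => χ x ^ 2) z.2‖ₑ +
          2 * ‖ϖ z.1 z.2‖ₑ * ‖w z.1 z.2‖ₑ * ‖gradient (fun x => χ x ^ 2) z.2‖ₑ)) = R₁ + R₂ + R₃ := by
      have m12 : AEMeasurable (fun z : ℝ × EuclideanSpace ℝ (Fin 3) =>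
          ‖w z.1 z.2‖ₑ ^ 2 * ‖(Δ (fun x => χ x ^ 2)) z.2‖ₑ +
          ‖w z.1 z.2‖ₑ ^ 2 * ‖mollifiedDrift η ε w z.1 z.2‖ₑ * ‖gradient (fun x => χ x ^ 2) z.2‖ₑ)
          (volume.restrict (Ioo (0 : ℝ) t ×ˢ (univ : Set (EuclideanSpace ℝ (Fin 3))))) := m1.add m2
      rw [hR₁, hR₂, hR₃, ← lintegral_add_left' m1, ← lintegral_add_left' m12]
    -- the second term of (3.7): (3.6)
    have hR₁le : R₁ ≤ K₁ * Φ := by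
      have h1 : R₁ ≤ ∫⁻ z in Ioo 0 t ×ˢ ball (0 : EuclideanSpace ℝ (Fin 3)) c,
          ENNReal.ofReal MΔ * ‖w z.1 z.2‖ₑ ^ 2 := by
        refine setLIntegral_prod_univ_le_of_eq_zero_off measurableSet_Ioo measurableSet_ball
          (fun z _ => ?_) (fun z hz => ?_)
        · exact (mul_le_mul' le_rfl (eΔ _)).trans_eq (mul_comm _ _)
        · rw [hΔ0 z.2 hz.2, enorm_zero, mul_zero]
      have h2 := setLIntegral_cylinder_enorm_sq_le_of_dss hc h.dss ht0
      have h3 : ∫⁻ s in Ioo 0 t, supBallEnergy w s ≤ Φ := lintegral_mono fun s => le_add_self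
      calc R₁ ≤ ∫⁻ z in Ioo 0 t ×ˢ ball (0 : EuclideanSpace ℝ (Fin 3)) c,
            ENNReal.ofReal MΔ * ‖w z.1 z.2‖ₑ ^ 2 := h1
        _ = ENNReal.ofReal MΔ * ∫⁻ z in Ioo 0 t ×ˢ ball (0 : EuclideanSpace ℝ (Fin 3)) c,
            ‖w z.1 z.2‖ₑ ^ 2 := lintegral_const_mul' _ _ ENNReal.ofReal_ne_top
        _ ≤ ENNReal.ofReal MΔ * (ENNReal.ofReal (c ^ 3) * Φ) :=
            mul_le_mul' le_rfl (h2.trans (mul_le_mul' le_rfl h3))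
        _ = K₁ * Φ := by rw [hK₁, mul_assoc]
    -- the cubic term: (3.9)–(3.11) and Gagliardo–Nirenberg
    have hcubic := hcube w h.dss hws1 cDw t ht0
    have hR₂le : R₂ ≤ K₂ * (Cc * Φ + γ * D) := by
      have h1 : R₂ ≤ ∫⁻ z in Ioo 0 t ×ˢ ball (0 : EuclideanSpace ℝ (Fin 3)) c,
          ENNReal.ofReal Mg * (‖w z.1 z.2‖ₑ ^ 2 * ‖mollifiedDrift η ε w z.1 z.2‖ₑ) := by
        refine setLIntegral_prod_univ_le_of_eq_zero_off measurableSet_Ioo measurableSet_ball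
          (fun z _ => ?_) (fun z hz => ?_)
        · exact (mul_le_mul' le_rfl (eg _)).trans_eq (mul_comm _ _)
        · rw [hg0 z.2 hz.2, enorm_zero, mul_zero]
      have h2 := setLIntegral_cylinder_sq_mul_drift_le hc hη.continuous hη0 hη1 hηρ hε hερ
        finrank_euclideanSpace_fin h.dss cw ht0 ht1
      calc R₂ ≤ ∫⁻ z in Ioo 0 t ×ˢ ball (0 : EuclideanSpace ℝ (Fin 3)) c,
            ENNReal.ofReal Mg * (‖w z.1 z.2‖ₑ ^ 2 * ‖mollifiedDrift η ε w z.1 z.2‖ₑ) := h1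
        _ = ENNReal.ofReal Mg * ∫⁻ z in Ioo 0 t ×ˢ ball (0 : EuclideanSpace ℝ (Fin 3)) c,
            ‖w z.1 z.2‖ₑ ^ 2 * ‖mollifiedDrift η ε w z.1 z.2‖ₑ :=
            lintegral_const_mul' _ _ ENNReal.ofReal_ne_top
        _ ≤ ENNReal.ofReal Mg * ((ENNReal.ofReal (c ^ 2) + ENNReal.ofReal (c ^ 4)) *
            (Cc * Φ + γ * D)) := mul_le_mul' le_rfl (h2.trans (mul_le_mul' le_rfl hcubic))
        _ = K₂ * (Cc * Φ + γ * D) := by rw [hK₂, mul_assoc]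
    -- the pressure term: Young, the pressure bound from (3.8), and the cubic bound on `B_λ`
    have hpressure := hpress ε w ϖ hε hερ h.dss cw hws cDw h.pressure_formula t ht0 ht1
    have hR₃le : R₃ ≤ K₃ * ((Cp * Φ + γ * D) + ENNReal.ofReal (c ^ 2) * (Cc * Φ + γ * D)) := by
      have h1 : R₃ ≤ ∫⁻ z in Ioo 0 t ×ˢ ball (0 : EuclideanSpace ℝ (Fin 3)) c,
          K₃ * (‖ϖ z.1 z.2‖ₑ * ‖w z.1 z.2‖ₑ) := by
        refine setLIntegral_prod_univ_le_of_eq_zero_off measurableSet_Ioo measurableSet_ball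
          (fun z _ => ?_) (fun z hz => ?_)
        · rw [hK₃]
          calc 2 * ‖ϖ z.1 z.2‖ₑ * ‖w z.1 z.2‖ₑ * ‖gradient (fun x => χ x ^ 2) z.2‖ₑ
              ≤ 2 * ‖ϖ z.1 z.2‖ₑ * ‖w z.1 z.2‖ₑ * ENNReal.ofReal Mg := mul_le_mul' le_rfl (eg _)
            _ = 2 * ENNReal.ofReal Mg * (‖ϖ z.1 z.2‖ₑ * ‖w z.1 z.2‖ₑ) := by ring
        · rw [hg0 z.2 hz.2, enorm_zero, mul_zero]
      have mw3 : AEMeasurable (fun z : ℝ × EuclideanSpace ℝ (Fin 3) => ‖w z.1 z.2‖ₑ ^ (3 : ℝ))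
          (volume.restrict (Ioo (0 : ℝ) t ×ˢ ball (0 : EuclideanSpace ℝ (Fin 3)) c)) :=
        (aestronglyMeasurable_restrict_of_continuousOn cw' t measurableSet_ball).enorm.pow_const _
      have h2 : ∫⁻ z in Ioo 0 t ×ˢ ball (0 : EuclideanSpace ℝ (Fin 3)) c, ‖ϖ z.1 z.2‖ₑ * ‖w z.1 z.2‖ₑ ≤
          (∫⁻ z in Ioo 0 t ×ˢ ball (0 : EuclideanSpace ℝ (Fin 3)) c, ‖ϖ z.1 z.2‖ₑ ^ (3 / 2 : ℝ)) +
            ∫⁻ z in Ioo 0 t ×ˢ ball (0 : EuclideanSpace ℝ (Fin 3)) c, ‖w z.1 z.2‖ₑ ^ (3 : ℝ) := by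
        rw [← lintegral_add_right' _ mw3]
        exact lintegral_mono fun z => mul_le_rpow_three_halves_add_rpow_three _ _
      have h3 := setLIntegral_cylinder_enorm_cube_le_of_dss hc h.dss ht0
      calc R₃ ≤ ∫⁻ z in Ioo 0 t ×ˢ ball (0 : EuclideanSpace ℝ (Fin 3)) c,
            K₃ * (‖ϖ z.1 z.2‖ₑ * ‖w z.1 z.2‖ₑ) := h1
        _ = K₃ * ∫⁻ z in Ioo 0 t ×ˢ ball (0 : EuclideanSpace ℝ (Fin 3)) c,
            ‖ϖ z.1 z.2‖ₑ * ‖w z.1 z.2‖ₑ := lintegral_const_mul' _ _ hK₃t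
        _ ≤ K₃ * ((Cp * Φ + γ * D) + ENNReal.ofReal (c ^ 2) * (Cc * Φ + γ * D)) :=
            mul_le_mul' le_rfl (h2.trans (add_le_add hpressure
              (h3.trans (mul_le_mul' le_rfl hcubic))))
    -- collect: the right-hand side of (3.7) is at most `α₀ + C'Φ + SγD ≤ α₀ + C'Φ + D`
    have hsum : R₁ + R₂ + R₃ ≤ C' * Φ + S * γ * D := by
      calc R₁ + R₂ + R₃ ≤ K₁ * Φ + K₂ * (Cc * Φ + γ * D) +
            K₃ * ((Cp * Φ + γ * D) + ENNReal.ofReal (c ^ 2) * (Cc * Φ + γ * D)) :=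
            add_le_add (add_le_add hR₁le hR₂le) hR₃le
        _ = C' * Φ + S * γ * D := by rw [hC', hS]; ring
    have hE' : 𝔄 + 2 * D ≤ α₀ + C' * Φ + D := by
      calc 𝔄 + 2 * D ≤ (∫⁻ x, ‖v₀ x‖ₑ ^ 2 * ENNReal.ofReal (χ x ^ 2)) + (R₁ + R₂ + R₃) := by
            rw [← hsplit]; exact E
        _ ≤ α₀ + (C' * Φ + S * γ * D) := add_le_add hA₀ψ hsum
        _ ≤ α₀ + (C' * Φ + 1 * D) := by gcongr
        _ = α₀ + C' * Φ + D := by rw [one_mul, add_assoc]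
    have habs : 𝔄 + D ≤ α₀ + C' * Φ := add_le_of_add_two_mul_le hDt hE'
    -- the left-hand side dominates the printed one
    have hball : ballEnergy w t ≤ 𝔄 := by
      calc ballEnergy w t = ∫⁻ x in ball (0 : EuclideanSpace ℝ (Fin 3)) 1,
            ‖w t x‖ₑ ^ 2 * ENNReal.ofReal (χ x ^ 2) :=
            setLIntegral_congr_fun measurableSet_ball fun x hx => by rw [hψB x hx, ENNReal.ofReal_one, mul_one]
        _ ≤ 𝔄 := setLIntegral_le_lintegral _ _
    have hgrad : (∫⁻ z in Ioo 0 t ×ˢ ball (0 : EuclideanSpace ℝ (Fin 3)) 1,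
        ENNReal.ofReal (frobeniusNormSq (fderiv ℝ (w z.1) z.2))) ≤ D := by
      calc (∫⁻ z in Ioo 0 t ×ˢ ball (0 : EuclideanSpace ℝ (Fin 3)) 1,
            ENNReal.ofReal (frobeniusNormSq (fderiv ℝ (w z.1) z.2)))
          = ∫⁻ z in Ioo 0 t ×ˢ ball (0 : EuclideanSpace ℝ (Fin 3)) 1,
            ENNReal.ofReal (χ z.2 ^ 2 * frobeniusNormSq (fderiv ℝ (w z.1) z.2)) :=
            setLIntegral_congr_fun (measurableSet_Ioo.prod measurableSet_ball) fun z hz => by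
              rw [hψB z.2 hz.2, one_mul]
        _ ≤ D := lintegral_mono_set (prod_mono subset_rfl (subset_univ _))
    refine ⟨(add_le_add hball hgrad).trans habs, ?_⟩
    calc (∫⁻ z in Ioo 0 t ×ˢ ball (0 : EuclideanSpace ℝ (Fin 3)) c, ‖ϖ z.1 z.2‖ₑ ^ (3 / 2 : ℝ))
        ≤ Cp * Φ + γ * D := hpressure
      _ ≤ Cp * Φ + 1 * D := by gcongr
      _ ≤ Cp * Φ + (𝔄 + D) := by rw [one_mul]; exact add_le_add le_rfl le_add_self
      _ ≤ Cp * Φ + (α₀ + C' * Φ) := add_le_add le_rfl habs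
  -- ### the two clauses
  refine ⟨fun t ht0 ht1 => ?_, fun t ht0 ht1 => ?_⟩
  · obtain ⟨h1, -⟩ := core t ht0 ht1
    refine h1.trans (add_le_add le_rfl (mul_le_mul' hC'C₀ le_rfl))
  · obtain ⟨h1, h2⟩ := core t ht0 ht1
    set Φ : ℝ≥0∞ := ∫⁻ s in Ioo 0 t, (supBallEnergy w s ^ 3 + supBallEnergy w s) with hΦ
    calc (∫⁻ z in Ioo 0 t ×ˢ ball (0 : EuclideanSpace ℝ (Fin 3)) 1, ‖ϖ z.1 z.2‖ₑ ^ (3 / 2 : ℝ))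
        ≤ ∫⁻ z in Ioo 0 t ×ˢ ball (0 : EuclideanSpace ℝ (Fin 3)) c, ‖ϖ z.1 z.2‖ₑ ^ (3 / 2 : ℝ) :=
          lintegral_mono_set (prod_mono subset_rfl (ball_subset_ball hc.le))
      _ ≤ Cp * Φ + (α₀ + C' * Φ) := h2
      _ = α₀ + (Cp + C') * Φ := by ring
      _ ≤ C₀ * α₀ + C₀ * Φ := add_le_add (le_mul_of_one_le_left' h1C₀) (mul_le_mul' hCpC₀ le_rfl)
      _ = C₀ * (α₀ + Φ) := (mul_add _ _ _).symm

end Literature.Analysis.FluidPDE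

end
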